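import Summits.BirchSwinnertonDyer.Rank1Residual.GaloisImage.WildNineTorsionValuation
import HarnessLib

/-!
# The SINGLE-SLOPE regime `v₃(j − 1728) ≥ 5` of the wild normal shape at `3`: the `3`-torsion
# abscissae, ordinates and their separation
# (cell `b2b-bsdres`, team n1011, seat p02 gen 3, OWNERS row T-b10 'wild tower at 3' ARM A, file F3a)

HONEST FRAMING (cell `b2b-bsdres`, run/shared/lean/b2b/bsd-rank1-residual/, verbatim in every
file): the goal of the cell is to DELETE the COMBINATION-SHAPED residual classes of the
Birch–Swinnerton-Dyer formula for ALL analytic-rank `≤ 1` elliptic curves over `ℚ` — "full BSD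
formula for every rank `≤ 1` curve in class `C`" assembled STRICTLY from published theorems — so
that the rank-`≤ 1` remainder becomes exactly the CONSTRUCTION-SHAPED classes, which are TYPED
(missing-input `Prop`s), NOT attempted. This is not "finishing BSD". Team n1011 (N10 / N11, the
additive block X4 ∧ `p = 3`): research route on the CONSTRUCTION-SHAPED class X4; no claim beyond the
stated classes; nothing is booked. Theorems only (no definition, no named fact).

## What this file proves (`v` = the place over `3`, `t = v(3)`; normal shape `a₁ = a₃ = a₆ = 0`,
`a₄ = 1` with `v(a₂)⁶ ≤ t⁵` — the regime `m = v₃(j − 1728) ≥ 5` of `WildShapeValuation`, where the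
Hasse valuation is `≥ 3/4` and the Newton polygons of `[3]` and `[9]` have ONE slope)

* `valuation_pow_four_of_isRoot_Ψ₃_wild5` — every root `ξ` of `ψ₃ = 3X⁴ + 4a₂X³ + 6X² − 1` has
  `v(ξ)⁴·t = 1` (valuation `−1/4`); `valuation_Y_pow_eight_wild5` — the ordinate `η` of a `3`-torsion
  point has `v(η)⁸·t³ = 1` (valuation `−3/8`: denominator `8`, whence `8 ∣ #ρ̄_{E,3}(I)` and the
  tameness input `3 ∤ #ρ̄_{E,3}(I)` of the inertia criterion);
* `valuation_sub_pow_four_of_mem_roots_Ψ₃_wild5` — ROOT SEPARATION at level `3`: for `ξ₂` in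
  `ψ₃.roots.erase ξ₁`, `v(ξ₁ − ξ₂)⁴·t = 1` (`ψ₃'(ξ₁) = 12ξ₁(ξ₁² + a₂ξ₁ + 1)` has valuation `t·v(ξ₁)³`,
  and `ψ₃'(ξ₁) = 3∏(ξ₁ − ξⱼ)` with each factor `≤ v(ξ₁)`);
Sequel F3b (`WildFiveNineTorsionValuation`): the `9`-torsion abscissae (`v(x)³⁶t = 1`) and the
cross-class root separation `v(x − r)³⁶t = 1`; F3c (`WildFiveThreeAdicTower`): `ρ̄_{E,3}` onto and
`v₃(j − 1728) ≥ 5` ⟹ the `3`-adic tower, by p02 gen-2's criterion `9 ∣ e₉ ∧ 3 ∤ e₃`.  Numerics (EVIDENCE, `HOME/b2b-bsdres-n1011-p02/wild/`): on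
the `m = 5` cells all four `3`-torsion ordinates have valuation `v₃(Δ)/4 − 3/8` and all 36 values
`ψ₉'(x_Q)/…` are equal, as the two separations predict; on `m = 3` cells they split `27 + 9`.

References: N. Katz (1973) §3.10; J.-P. Serre, Invent. Math. 15 (1972) §1; Silverman *AEC* Ex. 3.7.
-/

noncomputable section

-- numerals `x ^ 36` etc. on the value group: see `WildShapeValuation`
set_option maxRecDepth 10000

open scoped Classical

open Polynomial WeierstrassCurve

namespace Summit.BirchSwinnertonDyer.Rank1Residual.GaloisImage

open Literature.NumberTheory.EllipticCurves

/-! ### §0 A product of factors `≤ u` equal to `u^{card}` has all factors `= u` -/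

section Generic

variable {Γ₀ : Type*} [LinearOrderedCommGroupWithZero Γ₀]

/-- In a linearly ordered commutative group with zero: if every `f x ≤ u` (`x ∈ s`) and
`∏ f x = u ^ #s ≠ 0`, then every `f x = u`. [folklore] -/
theorem eq_of_prod_map_eq_pow_card {ι : Type*} {s : Multiset ι} {f : ι → Γ₀} {u : Γ₀} (hu : u ≠ 0)
    (hle : ∀ x ∈ s, f x ≤ u) (hprod : (s.map f).prod = u ^ Multiset.card s) :
    ∀ x ∈ s, f x = u := by
  intro x hx
  by_contra hne
  have hlt : f x < u := lt_of_le_of_ne (hle x hx) hne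
  obtain ⟨s', rfl⟩ := Multiset.exists_cons_of_mem hx
  rw [Multiset.map_cons, Multiset.prod_cons, Multiset.card_cons, pow_succ'] at hprod
  have hrest : (s'.map f).prod ≤ u ^ Multiset.card s' := by
    have := Multiset.prod_le_pow_card (s'.map f) u (fun y hy ↦ by
      obtain ⟨z, hz, rfl⟩ := Multiset.mem_map.mp hy
      exact hle z (Multiset.mem_cons_of_mem hz))
    simpa using this
  have : f x * (s'.map f).prod < u * u ^ Multiset.card s' :=
    calc f x * (s'.map f).prod ≤ f x * u ^ Multiset.card s' := mul_le_mul' le_rfl hrest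
      _ < u * u ^ Multiset.card s' := mul_lt_mul_right_of_ne_zero' (pow_ne_zero _ hu) hlt
  exact absurd hprod (ne_of_lt this)

end Generic

variable {W : WeierstrassCurve (AlgebraicClosure ℚ)}

/-! ### §1 The `3`-torsion: all abscissae at `−1/4`, ordinates at `−3/8`, separation `−1/4` -/

/-- **Every root of `ψ₃` has `v(ξ)⁴·t = 1`** in the single-slope regime `v(a₂)⁶ ≤ t⁵`: above that
valuation `3ξ⁴` dominates, below it `−1` does. [folklore] -/
theorem valuation_pow_four_of_isRoot_Ψ₃_wild5 (h1 : W.a₁ = 0) (h3 : W.a₃ = 0) (h4 : W.a₄ = 1)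
    (h6 : W.a₆ = 0)
    (hA : (placeOver 3).valuation W.a₂ ^ 6 ≤ (placeOver 3).valuation (3 : AlgebraicClosure ℚ) ^ 5)
    {x : AlgebraicClosure ℚ} (hx : W.Ψ₃.IsRoot x) :
    (placeOver 3).valuation x ^ 4 * (placeOver 3).valuation (3 : AlgebraicClosure ℚ) = 1 := by
  set v := (placeOver 3).valuation with hv
  set t := v (3 : AlgebraicClosure ℚ) with ht
  have ht1 : t < 1 := valuation_three_lt_one
  have ht0 : t ≠ 0 := valuation_three_ne_zero
  set α := v W.a₂ with hαdef
  set u := v x with hu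
  have heval : 3 * x ^ 4 + 4 * W.a₂ * x ^ 3 + 6 * x ^ 2 - 1 = 0 := by
    have := hx; rwa [IsRoot.def, eval_Ψ₃_of_shape h1 h3 h4 h6] at this
  have h4' : v (4 : AlgebraicClosure ℚ) = 1 := by
    simpa using valuation_intCast_eq_one_of_not_dvd (n := 4) (by decide)
  have h6' : v (6 : AlgebraicClosure ℚ) = t := by
    rw [show (6 : AlgebraicClosure ℚ) = 2 * 3 by norm_num, map_mul,
      show v (2 : AlgebraicClosure ℚ) = 1 by
        simpa using valuation_intCast_eq_one_of_not_dvd (n := 2) (by decide), one_mul]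
  have hD4 : v (3 * x ^ 4) = t * u ^ 4 := by rw [map_mul, map_pow]
  have hD3 : v (4 * W.a₂ * x ^ 3) = α * u ^ 3 := by rw [map_mul, map_mul, h4', one_mul, map_pow]
  have hD2 : v (6 * x ^ 2) = t * u ^ 2 := by rw [map_mul, h6', map_pow]
  have hD0 : v (1 : AlgebraicClosure ℚ) = 1 := map_one v
  have hα12 : α ^ 12 ≤ t ^ 10 := by
    calc α ^ 12 = (α ^ 6) ^ 2 := by rw [← pow_mul]
      _ ≤ (t ^ 5) ^ 2 := pow_le_pow_left₀ zero_le hA 2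
      _ = t ^ 10 := by rw [← pow_mul]
  set T := u ^ 4 * t with hT
  rcases lt_trichotomy 1 T with hgt | heq | hlt
  · -- `3ξ⁴` dominates
    exfalso
    have hu0 : u ≠ 0 := by
      rintro h0; rw [hT, h0, zero_pow (by norm_num), zero_mul] at hgt; exact not_lt_zero hgt
    have hu1 : 1 < u := by
      by_contra hle; rw [not_lt] at hle
      have : T ≤ 1 := by
        calc T = u ^ 4 * t := rfl
          _ ≤ 1 * 1 := mul_le_mul' (pow_le_one₀ zero_le hle) ht1.le
          _ = 1 := mul_one _
      exact absurd (hgt.trans_le this) (lt_irrefl _)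
    have hi : α * u ^ 3 < t * u ^ 4 := by
      have hαtu : α < t * u := by
        refine lt_of_pow_lt_pow_left₀ 12 zero_le ?_
        have e : (t * u) ^ 12 = t ^ 9 * T ^ 3 := by
          rw [mul_pow, hT, mul_pow, ← pow_mul, show 4 * 3 = 12 from rfl,
            show t ^ 12 = t ^ 9 * t ^ 3 by rw [← pow_add]]
          simp only [mul_assoc, mul_comm]
        rw [e]
        calc α ^ 12 ≤ t ^ 10 := hα12
          _ < t ^ 9 := (pow_lt_pow_iff_of_lt_one' ht0 ht1).mpr (by norm_num)
          _ = t ^ 9 * 1 := (mul_one _).symm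
          _ < t ^ 9 * T ^ 3 := mul_lt_mul_left_of_ne_zero (pow_ne_zero _ ht0) (one_lt_pow₀ hgt three_ne_zero)
      calc α * u ^ 3 < t * u * u ^ 3 := mul_lt_mul_right_of_ne_zero' (pow_ne_zero _ hu0) hαtu
        _ = t * u ^ 4 := by rw [mul_assoc, ← pow_succ']
    have hii : t * u ^ 2 < t * u ^ 4 := by
      refine mul_lt_mul_left_of_ne_zero ht0 ?_
      calc u ^ 2 = u ^ 2 * 1 := (mul_one _).symm
        _ < u ^ 2 * u ^ 2 := mul_lt_mul_left_of_ne_zero (pow_ne_zero _ hu0) (one_lt_pow₀ hu1 two_ne_zero)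
        _ = u ^ 4 := by rw [← pow_add]
    have hiii : (1 : _) < t * u ^ 4 := by rwa [mul_comm]
    have hr : v (4 * W.a₂ * x ^ 3 + 6 * x ^ 2 - 1) < v (3 * x ^ 4) := by
      rw [hD4]
      refine Valuation.map_sub_lt _ (Valuation.map_add_lt _ ?_ ?_) ?_
      · rwa [hD3]
      · rwa [hD2]
      · rwa [hD0]
    refine false_of_dominant v ?_ hr
    rw [← heval]; ring
  · exact heq.symm
  · -- `−1` dominates
    exfalso
    have hi : α * u ^ 3 < 1 := by
      refine lt_of_pow_lt_pow_left₀ 12 zero_le ?_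
      rw [one_pow]
      have e : (α * u ^ 3) ^ 12 * t ^ 9 = α ^ 12 * T ^ 9 := by
        rw [mul_pow, hT, mul_pow, ← pow_mul, ← pow_mul, show 3 * 12 = 4 * 9 from rfl]
        simp only [mul_assoc, mul_comm, mul_left_comm]
      have key : (α * u ^ 3) ^ 12 * t ^ 9 < 1 * t ^ 9 := by
        rw [e, one_mul]
        calc α ^ 12 * T ^ 9 ≤ t ^ 10 * 1 :=
              mul_le_mul' hα12 (pow_le_one₀ zero_le hlt.le)
          _ = t ^ 10 := mul_one _
          _ < t ^ 9 := (pow_lt_pow_iff_of_lt_one' ht0 ht1).mpr (by norm_num)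
      exact lt_of_mul_lt_mul_right' key
    have hii : t * u ^ 2 < 1 := by
      refine lt_of_pow_lt_pow_left₀ 2 zero_le ?_
      rw [one_pow, mul_pow, ← pow_mul, show 2 * 2 = 4 by norm_num, pow_two, mul_assoc,
        mul_comm t (u ^ 4), ← hT]
      exact mul_lt_one_of_nonneg_of_lt_one_right ht1.le zero_le hlt
    have hiii : t * u ^ 4 < 1 := by rwa [mul_comm]
    have hr : v (3 * x ^ 4 + 4 * W.a₂ * x ^ 3 + 6 * x ^ 2) < v (-1 : AlgebraicClosure ℚ) := by
      rw [Valuation.map_neg, hD0]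
      refine Valuation.map_add_lt _ (Valuation.map_add_lt _ ?_ ?_) ?_
      · rwa [hD4]
      · rwa [hD3]
      · rwa [hD2]
    refine false_of_dominant v ?_ hr
    rw [← heval]; ring

/-- **The ordinate of a `3`-torsion point has `v(η)⁸·t³ = 1`** (valuation `−3/8`): on
`η² = ξ³ + a₂ξ² + ξ` with `v(ξ)⁴t = 1` the term `ξ³` dominates. [folklore] -/
theorem valuation_Y_pow_eight_wild5 (h1 : W.a₁ = 0) (h3 : W.a₃ = 0) (h4 : W.a₄ = 1) (h6 : W.a₆ = 0)
    (hA : (placeOver 3).valuation W.a₂ ^ 6 ≤ (placeOver 3).valuation (3 : AlgebraicClosure ℚ) ^ 5)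
    {x y : AlgebraicClosure ℚ} (hxy : W.toAffine.Equation x y)
    (hx : (placeOver 3).valuation x ^ 4 * (placeOver 3).valuation (3 : AlgebraicClosure ℚ) = 1) :
    (placeOver 3).valuation y ^ 8 * (placeOver 3).valuation (3 : AlgebraicClosure ℚ) ^ 3 = 1 := by
  set v := (placeOver 3).valuation with hv
  set t := v (3 : AlgebraicClosure ℚ) with ht
  have ht1 : t < 1 := valuation_three_lt_one
  have ht0 : t ≠ 0 := valuation_three_ne_zero
  set α := v W.a₂ with hαdef
  set β := v x with hβ
  have hα1 : α < 1 := by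
    by_contra hle; rw [not_lt] at hle
    have : 1 ≤ α ^ 6 := one_le_pow₀ hle
    exact absurd ((this.trans hA).trans_lt (pow_lt_one₀ zero_le ht1 (by norm_num))) (lt_irrefl _)
  have hβ1 : 1 < β := by
    by_contra hle; rw [not_lt] at hle
    have : β ^ 4 * t ≤ 1 * t := mul_le_mul' (pow_le_one₀ zero_le hle) le_rfl
    rw [hx, one_mul] at this
    exact absurd (this.trans_lt ht1) (lt_irrefl _)
  have hβ0 : β ≠ 0 := ne_of_gt (lt_trans zero_lt_one hβ1)
  have heq : y ^ 2 = x ^ 3 + W.a₂ * x ^ 2 + x := by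
    have := (Affine.equation_iff ..).mp hxy
    rw [h1, h3, h4, h6] at this
    linear_combination this
  have hd2 : v (W.a₂ * x ^ 2) < v (x ^ 3) := by
    rw [map_mul, map_pow, map_pow]
    calc α * β ^ 2 < 1 * β ^ 2 := mul_lt_mul_right_of_ne_zero' (pow_ne_zero _ hβ0) hα1
      _ < β * β ^ 2 := mul_lt_mul_right_of_ne_zero' (pow_ne_zero _ hβ0) hβ1
      _ = β ^ 3 := by rw [← pow_succ']
  have hd1 : v x < v (x ^ 3 + W.a₂ * x ^ 2) := by
    rw [Valuation.map_add_eq_of_lt_left _ hd2, map_pow]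
    calc β = β * 1 := (mul_one _).symm
      _ < β * β ^ 2 := mul_lt_mul_left_of_ne_zero hβ0 (one_lt_pow₀ hβ1 two_ne_zero)
      _ = β ^ 3 := by rw [← pow_succ']
  have hvy2 : v y ^ 2 = β ^ 3 := by
    rw [← map_pow, heq, Valuation.map_add_eq_of_lt_left _ hd1, Valuation.map_add_eq_of_lt_left _ hd2,
      map_pow]
  calc v y ^ 8 * t ^ 3 = (v y ^ 2) ^ 4 * t ^ 3 := by rw [← pow_mul]
    _ = (β ^ 4 * t) ^ 3 := by rw [hvy2, ← pow_mul, mul_pow, ← pow_mul]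
    _ = 1 := by rw [hx, one_pow]

/-- **Root separation at level `3`**: for `ξ₂ ∈ ψ₃.roots.erase ξ₁` (both roots, the second taken from
the multiset with `ξ₁` removed once), `v(ξ₁ − ξ₂)⁴·t = 1` — the roots of `ψ₃` are mutually at the same
`3`-adic distance as their size.  Indeed `ψ₃' (ξ₁) = 12ξ₁³ + 12a₂ξ₁² + 12ξ₁` has valuation `t·v(ξ₁)³`
(`12ξ₁³` dominates), while `ψ₃ = 3∏(X − ξⱼ)` gives `ψ₃'(ξ₁) = 3∏_{j ≠ 1}(ξ₁ − ξⱼ)` with three factors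
each `≤ v(ξ₁)`. [folklore] -/
theorem valuation_sub_pow_four_of_mem_roots_Ψ₃_wild5 (h1 : W.a₁ = 0) (h3 : W.a₃ = 0) (h4 : W.a₄ = 1)
    (h6 : W.a₆ = 0)
    (hA : (placeOver 3).valuation W.a₂ ^ 6 ≤ (placeOver 3).valuation (3 : AlgebraicClosure ℚ) ^ 5)
    {ξ₁ ξ₂ : AlgebraicClosure ℚ} (hξ₁ : ξ₁ ∈ W.Ψ₃.roots) (hξ₂ : ξ₂ ∈ W.Ψ₃.roots.erase ξ₁) :
    (placeOver 3).valuation (ξ₁ - ξ₂) ^ 4 * (placeOver 3).valuation (3 : AlgebraicClosure ℚ) = 1 := by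
  set v := (placeOver 3).valuation with hv
  set t := v (3 : AlgebraicClosure ℚ) with ht
  have ht1 : t < 1 := valuation_three_lt_one
  have ht0 : t ≠ 0 := valuation_three_ne_zero
  have hW3 : (3 : AlgebraicClosure ℚ) ≠ 0 := by norm_num
  set F := W.Ψ₃ with hF
  have hF0 : F ≠ 0 := by
    intro h0; have := W.natDegree_Ψ₃ hW3; rw [← hF, h0, natDegree_zero] at this
    exact absurd this (by norm_num)
  have hsplit := IsAlgClosed.splits F
  have hlc : F.leadingCoeff = 3 := by rw [hF]; exact W.leadingCoeff_Ψ₃ hW3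
  have hprod : F = C (3 : AlgebraicClosure ℚ) * (F.roots.map (X - C ·)).prod := by
    rw [← hlc]; exact hsplit.eq_prod_roots
  -- every root has `v(ξ)⁴ t = 1`
  set u := v ξ₁ with hu
  have hroot : ∀ r ∈ F.roots, v r ^ 4 * t = 1 := fun r hr ↦
    valuation_pow_four_of_isRoot_Ψ₃_wild5 h1 h3 h4 h6 hA ((mem_roots hF0).mp hr)
  have hu4 : u ^ 4 * t = 1 := hroot ξ₁ hξ₁
  have hu0 : u ≠ 0 := by
    rintro h0; rw [h0, zero_pow (by norm_num), zero_mul] at hu4; exact zero_ne_one hu4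
  have hu1 : 1 < u := by
    by_contra hle; rw [not_lt] at hle
    have : u ^ 4 * t ≤ 1 * t := mul_le_mul' (pow_le_one₀ zero_le hle) le_rfl
    rw [hu4, one_mul] at this
    exact absurd (this.trans_lt ht1) (lt_irrefl _)
  have hveq : ∀ r ∈ F.roots, v r = u := fun r hr ↦
    pow_left_injective_of_ne_zero (n := 4) (by norm_num)
      (mul_right_cancel₀ ht0 ((hroot r hr).trans hu4.symm))
  -- the derivative at `ξ₁`, two ways
  have hder : (derivative F).eval ξ₁ = 3 * ((F.roots.erase ξ₁).map (fun a ↦ ξ₁ - a)).prod := by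
    conv_lhs => rw [hprod]
    rw [derivative_C_mul, eval_mul, eval_C, eval_multiset_prod_X_sub_C_derivative hξ₁]
  have hder' : (derivative F).eval ξ₁ = 12 * ξ₁ ^ 3 + 12 * W.a₂ * ξ₁ ^ 2 + 12 * ξ₁ := by
    rw [hF, WeierstrassCurve.Ψ₃, b₂_of_shape h1, b₄_of_shape h1 h3 h4, b₆_of_shape h3 h6,
      b₈_of_shape h1 h3 h4 h6]
    simp only [derivative_add, derivative_mul, derivative_C, derivative_X_pow,
      derivative_ofNat, zero_mul, zero_add, add_zero, eval_add, eval_mul, eval_C, eval_pow,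
      eval_X, eval_ofNat, map_zero, mul_zero]
    push_cast
    ring
  -- valuation of `ψ₃'(ξ₁)`: `12ξ₁³` dominates
  have h12 : v (12 : AlgebraicClosure ℚ) = t := by
    rw [show (12 : AlgebraicClosure ℚ) = 4 * 3 by norm_num, map_mul,
      show v (4 : AlgebraicClosure ℚ) = 1 by
        simpa using valuation_intCast_eq_one_of_not_dvd (n := 4) (by decide), one_mul]
  set α := v W.a₂ with hαdef
  have hα1 : α < 1 := by
    by_contra hle; rw [not_lt] at hle
    have : 1 ≤ α ^ 6 := one_le_pow₀ hle
    exact absurd ((this.trans hA).trans_lt (pow_lt_one₀ zero_le ht1 (by norm_num))) (lt_irrefl _)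
  have hvder : v ((derivative F).eval ξ₁) = t * u ^ 3 := by
    rw [hder']
    have hd : v (12 * ξ₁ ^ 3) = t * u ^ 3 := by rw [map_mul, h12, map_pow]
    have hlt1 : v (12 * W.a₂ * ξ₁ ^ 2) < v (12 * ξ₁ ^ 3) := by
      rw [hd, map_mul, map_mul, h12, map_pow, mul_assoc]
      refine mul_lt_mul_left_of_ne_zero ht0 ?_
      calc α * u ^ 2 < 1 * u ^ 2 := mul_lt_mul_right_of_ne_zero' (pow_ne_zero _ hu0) hα1
        _ < u * u ^ 2 := mul_lt_mul_right_of_ne_zero' (pow_ne_zero _ hu0) hu1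
        _ = u ^ 3 := by rw [← pow_succ']
    have hlt2 : v (12 * ξ₁) < v (12 * ξ₁ ^ 3 + 12 * W.a₂ * ξ₁ ^ 2) := by
      rw [Valuation.map_add_eq_of_lt_left _ hlt1, hd, map_mul, h12]
      refine mul_lt_mul_left_of_ne_zero ht0 ?_
      calc u = u * 1 := (mul_one _).symm
        _ < u * u ^ 2 := mul_lt_mul_left_of_ne_zero hu0 (one_lt_pow₀ hu1 two_ne_zero)
        _ = u ^ 3 := by rw [← pow_succ']
    rw [Valuation.map_add_eq_of_lt_left _ hlt2, Valuation.map_add_eq_of_lt_left _ hlt1, hd]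
  -- so `∏_{j≠1} v(ξ₁ − ξⱼ) = u³` with each factor `≤ u`
  have hcard : Multiset.card F.roots = 4 := by
    rw [← W.natDegree_Ψ₃ hW3]; exact splits_iff_card_roots.mp hsplit
  have hcard' : Multiset.card (F.roots.erase ξ₁) = 3 := by
    rw [Multiset.card_erase_of_mem hξ₁, hcard]; rfl
  have hprodv : ((F.roots.erase ξ₁).map (fun a ↦ v (ξ₁ - a))).prod = u ^ 3 := by
    have := congrArg v hder
    rw [hvder, map_mul, map_multiset_prod, Multiset.map_map] at this
    exact (mul_left_cancel₀ ht0 this).symm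
  have hle : ∀ a ∈ F.roots.erase ξ₁, v (ξ₁ - a) ≤ u := by
    intro a ha
    refine (Valuation.map_sub_le _ le_rfl ?_)
    rw [hveq a (Multiset.mem_of_mem_erase ha)]
  have hall := eq_of_prod_map_eq_pow_card (f := fun a ↦ v (ξ₁ - a)) hu0 hle (by rw [hprodv, hcard'])
  have hξ := hall ξ₂ hξ₂
  rw [hξ, hu4]

end Summit.BirchSwinnertonDyer.Rank1Residual.GaloisImage

end
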